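import Mathlib
import HarnessLib
import HarnessLib.Audit
import Summits.CriticalPhenomena.Statement
import HarnessLib.Audit.Status.Attr

/-!
Route: BallOrbitComparison

# Route BallOrbitComparison — + boundary conditions on the Möbius orbit of the ball — inversion as a
renormalisation-free ratio law, GKS domain monotonicity as the comparison structure, bulk by
exhaustion

It suffices to show X_BO = RV ∧ BL ∧ OIR ∧ UBF ∧ NG (idea card
ball-orbit-loewner-nirenberg-comparison; carries over the
retired duplicate ising-potential-theory). Objects: for a continuum domain Ω ⊆ ℝ³ and mesh δ, the +
b.c. critical correlation
G_Ω^δ(y) := ⟨∏ σ_(y_i)⟩⁺ of the n.n. Ising model at β_c(3) in the lattice region {z ∈ ℤ³ : δz ∈ Ω}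
(spins outside frozen +;
L→∞ limit along boxes, antitone by GKS), the CANONICAL renormalisation ρ_c(δ) := ⟨σ_0
σ_(⌊1/δ⌋e_0)⟩^(-1/2) at β_c(3), and the
Möbius orbit of the ball 𝒪 = {balls, exteriors of balls, open half-spaces}. RV
(TwoPointRegularVariation): ρ_c is regularly varying,
ρ_c(cδ)/ρ_c(δ) → c^(−Δ), some Δ > 0 (η exists in power-law form, 2Δ = 1+η). BL (BallLimits): for
every R the ρ_c-renormalised
+ b.c. correlations in the lattice ball of radius R/δ converge locally uniformly off coincidences to
continuous limits S_R.
OIR (OrbitInversionRatio, the covariance crux): for Ω, Ω′ ∈ 𝒪 exchanged by the unit inversion ι and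
non-coincident x ∈ (Ω∖0)ⁿ,
G_Ω′^δ([ιx/δ]) / G_Ω^δ([x/δ]) → ∏‖x_i‖^(2Δ) — a renormalisation-free statement whose n = 1 instance
is Cardy's textbook
prediction ⟨σ⟩_ball-centre = 2^Δ · ⟨σ⟩_wall at distance R. UBF (UniformBoundaryForgetting):
uniformly in δ, a + sphere of radius
R → ∞ and a + grain of radius r → 0 are forgotten by ρ_c-renormalised correlations at scale 1. NG =
shared item 0636 (U₄ ≢ 0).
Glue (support, provable now given the cruxes): GKS domain monotonicity makes the bulk + state the
infimum of the ball states, so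
BL ∧ UBF give the bulk pointwise scaling limit S (HasPointwiseScalingLimit (criticalCorr 3) ρ_c S),
continuous, translation
invariant (lattice translations + continuity), scale covariant (RV), non-degenerate (canonical ρ_c +
Messager–Miracle-Solé);
OIR on the pair (B_R, exterior of B_(1/R)) ∧ UBF give IsInversionCovariant Δ S; the group lemma
⟨translations, ι⟩ = Möb(ℝ³∪∞)
(pure geometry, no regularity of S needed) gives IsMoebiusCovariant Δ S — rotations are OUTPUT; NG
gives HasNontrivialU4.
Lean: `TwoPointRegularVariation ∧ BallLimits ∧ OrbitInversionRatio ∧ UniformBoundaryForgetting ∧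
IsingEuclidUpgradeR4NonGaussian`

## Assembly
Pure logic, verified sorry-free in the planner's Sketch.lean/InlineCheck.lean (`assembly_inline`, 7
lines): RV gives Δ > 0 and the
regular variation; BulkFromBalls (fed Δ, BL, UBF) gives S with normalisation, ρ_c > 0 on (0,1],
HasPointwiseScalingLimit
(criticalCorr 3) ρ_c S, IsNondegenerateTwoPoint, IsTranslationInvariant, IsScaleCovariant Δ;
InversionFromOrbit (fed Δ, OIR, UBF, S)
gives IsInversionCovariant Δ S; MoebiusOfTranslationInversion gives IsMoebiusCovariant Δ S; 0636
gives HasNontrivialU4 S; the tuple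
⟨ρ_c, Δ, S, …⟩ is Literature.Probability.LatticeModels.CritIsing3DConformalLimit =
Ising3DConformalLimit (root abbrev).

Rationale: WHY THIS LINE. On the Möbius orbit 𝒪 of the ball two exact structures coexist: the Möbius group acts
transitively (ι swaps ball/exterior and
ball/half-space; uniqueness of the critical state, AizenmanDuminilCopinSidoravicius2015, makes ∞ an
ordinary point as the geometry
demands) and + b.c. correlations are MONOTONE in the domain (GKS, FriedliVelenik2017 Lemma 3.22 /
Ex. 3.12; in tree and proved:
isingCorr_plus_le_of_subset) — the same two structures (Möbius covariance u_(φΩ)∘φ = |φ′|^(−1/2)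
u_Ω, monotonicity Ω ⊆ Ω′ ⇒ u_Ω ≥ u_Ω′)
that characterise the Loewner–Nirenberg density u_Ω (maximal solution of Δu = ¾u⁵ blowing up at ∂Ω,
LoewnerNirenberg1974), the
3-D conformal radius, explicit on 𝒪: u_B = (2R/(R²−|x|²))^(1/2); the physics one-point law ⟨σ⟩⁺_Ω =
κ·u_Ω^(2Δ) is Cardy1996 Ex. 11.2 /
BurkhardtEisenriegler1985 on 𝒪 and Gori–Trombettoni's critical-geometry conjecture
(arXiv:1904.08919) beyond it. Imported areas:
conformal/hyperbolic geometry and the singular Yamabe PDE (as the ruler and, later, as comparison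
functions), elementary Möbius group
theory (⟨translations, ι⟩ = Möb), classical correlation inequalities as an ORDER structure; no RG,
no reflection positivity, no
planar maps. What it does that the open routes do not:
IsingEuclidUpgrade/IsingCFTData/HyperoctahedralRP attack covariance of the
BULK family through QFT axioms or nine-mirror RP and postulate or separately prove rotations; here
the inversion is a ratio identity
between two + b.c. lattice families (no ρ, no limit object, testable at n = 1 by Monte Carlo),
existence is moved to FINITE volume
(balls) plus one uniform boundary-influence estimate, and rotations and dilations come for free from
translations + inversion.
PRIOR PROGRAMME: docs/m5/inspiration not read (plancard mode).

RANKED CRUXES. #2 OrbitInversionRatio (crux) — (card D1, renormalisation-free form) let Δ be the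
regular-variation index of ρ_c. For Ω, Ω′ in the orbit 𝒪 (open balls, open exteriors of balls, open
half-spaces of ℝ³) with ι(Ω∖0) ⊆ Ω′ and ι(Ω′∖0) ⊆ Ω (ι = unit inversion x ↦ x/‖x‖²), every n and
every non-coincident x with x_i ∈ Ω∖{0}: G_Ω′^δ([ιx_1/δ],…,[ιx_n/δ]) / G_Ω^δ([x_1/δ],…,[x_n/δ]) →
∏_i ‖x_i‖^(2Δ) as δ → 0⁺. Covers ball↔exterior (0 inside), ball↔ball (0 outside), ball↔half-space (0
on the sphere), half-space↔half-space (0 on the plane); n = 1 on the last-but-one pair is the 2^Δ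
centre/wall law. [deps: TwoPointRegularVariation] [difficulty: open-problem] (why it might fail: It
is clause (ii) read on + b.c. domains: a scale- but not conformally covariant critical point (virial
current) would make ball and exterior/half-space correlations differ by a non-constant factor; GKS
sandwiches give only one-sided bounds (ratio ≤ 1 for nested pairs), no lattice identity is known.)
[Cardy1996, BurkhardtEisenriegler1985, arXiv:1904.08919, ChelkakHonglerIzyurov2015,
DuminilCopinICM2022, Hasenbusch2013]
#3 BallLimits (crux) — (card D2, finite-volume form) for every R > 0 there is a family S_R :
CorrFamily 3 such that for every n the ρ_c-renormalised + b.c. correlations of the lattice ball {z :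
|δz| < R} (a FINITE system), x ↦ ρ_c(δ)ⁿ G_(B_R)^δ([x_1/δ],…,[x_n/δ]), converge locally uniformly on
NonCoincident ∩ B_Rⁿ to S_R n as δ → 0⁺, and S_R n is continuous there. With
UniformBoundaryForgetting this yields the bulk limit (support BulkFromBalls): existence of the
scaling limit becomes a finite-volume problem plus one uniform estimate. [difficulty: open-problem]
(why it might fail: Finiteness under the bulk normalisation ρ_c contains two-point hyperscaling
⟨σ_0⟩^{+B_n} ≲ ⟨σ_0σ_{ne_0}⟩^{1/2} (one-arm ≤ √two-point), open on ℤ³ (no one-arm bound at all: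
arXiv:2406.15243 Open problem 1); and uniqueness of the δ→0 limit has no mechanism in d=3 beyond
subsequences.) [arXiv:2406.15243, AizenmanDuminilCopinSidoravicius2015, DuminilCopinICM2022,
FriedliVelenik2017, arXiv:1912.07973]
#4 UniformBoundaryForgetting (crux) — (card D3: exhaustion + removable grain, uniform in the mesh)
for every n, every compact K ⊆ NonCoincident 3 n and ε > 0: (far sphere) there is R₀ such that for
all R ≥ R₀, all sufficiently small δ > 0 and all x ∈ K, |ρ_c(δ)ⁿ (G_(B_R)^δ − G_(ℤ³))([x/δ])| < ε,
where G_(ℤ³) = criticalCorr 3 is the bulk + state; (small grain) if K avoids configurations through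
0, there is r₀ such that for all r ∈ (0, r₀], small δ and x ∈ K, |ρ_c(δ)ⁿ (G_({|y|>r})^δ −
G_(ℤ³))([x/δ])| < ε (+ grain of radius r/δ at the origin). Both differences are ≥ 0 and monotone in
R, r by GKS; the two halves are images of each other under ι. [difficulty: open-problem] (why it
might fail: It is a polynomial decay of + boundary influence across scales (FK-Ising one-arm type,
from a macroscopic + seed), UNIFORM in the mesh: open in d=3 even without uniformity (ADS continuity
gives →0 with no rate); slab moral: uniform control in the exhaustion parameter can be as hard as
the target.) [AizenmanDuminilCopinSidoravicius2015, arXiv:2406.15243, arXiv:1912.07973,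
Literature.Barriers.CriticalPhenomena.SlabLimitUniformControl, FriedliVelenik2017]
#5 TwoPointRegularVariation (crux) — there is Δ > 0 with ρ_c(cδ)/ρ_c(δ) → c^(−Δ) as δ → 0⁺ for every
c > 0, ρ_c(δ) = ⟨σ_0σ_(⌊1/δ⌋e_0)⟩_(β_c(3))^(−1/2); i.e. n ↦ ⟨σ_0σ_(ne_0)⟩_(β_c) is regularly varying
of index −2Δ = −(1+η) (existence of η in Karamata form). Fixes the route's Δ;
criticalTwoPoint_bounds then forces Δ ∈ [1/2, 1]. Strictly stronger than item 0635 (log form).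
[difficulty: open-problem] (why it might fail: η(3) need not exist: rigorously only c|x|⁻² ≤ G ≤
C|x|⁻¹ and 'η ≤ 1/2 if it exists' (arXiv:2404.05700 Thm 1.5); a log-periodic modulation |x|^{-1-η}(1
+ a·cos(ω log|x|)) is compatible with every known inequality (card
rp-cannot-fix-the-scale-log-periodic).) [arXiv:2404.05700, DuminilcopinPanis2025,
DuminilCopinICM2022, Literature.Probability.LatticeModels.criticalTwoPoint_bounds, Simon1980]
#6 IsingEuclidUpgradeR4NonGaussian (crux) — (shared item stmt-CriticalPhenomena-0636, verbatim)
every non-degenerate pointwise scaling limit S of the renormalised critical Ising correlators on ℤ³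
(any ρ > 0 on (0,1]) has connected four-point function U₄ ≢ 0 on non-coincident configurations.
Imported complement: this route does not attack clause (iii). [difficulty: open-problem] (why it
might fail: No proof that U4≢0 in d=3: via U4 = −2⟨σσ⟩⟨σσ⟩·P[two double-current clusters meet], the
intersection probability must stay >0 at macroscopic separation as δ→0 — unproved on n.n. ℤ³; RP
long-range models ON ℤ³ (α<3/2) are Gaussian.) [AizenmanDuminilCopinAnnals2021, arXiv:1912.07973,
Panis2023Triviality, Literature.Barriers.CriticalPhenomena.IsingTrivialityFromDimensionFour,
DuminilCopinICM2022]
#9 BulkFromBalls (support) — (glue, provable now given its antecedents) for Δ with ρ_c regularly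
varying of index −Δ: BallLimits → UniformBoundaryForgetting → there is S : CorrFamily 3, normalised
to 0 off NonCoincident, with ρ_c > 0 on (0,1] (criticalTwoPoint_bounds_holds),
HasPointwiseScalingLimit (criticalCorr 3) ρ_c S (GKS: bulk = inf of balls,
isingCorr_plus_le_of_subset + hasBoxLimit_isingCorr_plus_holds; Moore–Osgood with the uniform
estimate; S = lim_R S_R locally uniformly, hence continuous), IsNondegenerateTwoPoint S (canonical
normalisation S 2 (0,e_0) = 1, Messager–Miracle-Solé messager_miracleSole(_diag)_holds +
reflections), IsTranslationInvariant S (plusCorr_shift + continuity: [x/δ+v/δ] = [(x+δθ)/δ] +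
⌊v/δ⌋), IsScaleCovariant Δ S (δ ↦ cδ in the mesh filter + regular variation). [difficulty: L]
[FriedliVelenik2017, MessagerMiracleSoleJSP1977,
Literature.Probability.LatticeModels.isingCorr_plus_le_of_subset,
Literature.Probability.LatticeModels.plusCorr_shift]
#9 InversionFromOrbit (support) — (glue, provable now given its antecedents; ε-argument written out
in planner NOTES) for Δ with ρ_c regularly varying of index −Δ: OrbitInversionRatio →
UniformBoundaryForgetting → every S with HasPointwiseScalingLimit (criticalCorr 3) ρ_c S and S = 0
off NonCoincident is inversion covariant, IsInversionCovariant Δ S. Proof: for non-coincident x with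
x_i ≠ 0 pick R ≥ max(R₀, 1/r₀, 2 max‖x_i‖); OIR on the ι-pair (ball 0 R, {‖y‖ > 1/R}) gives
G_ext^δ([ιx/δ])/G_ball^δ([x/δ]) → ∏‖x_i‖^(2Δ); UBF puts ρ_cⁿG_ball^δ([x/δ]) within ε of
ρ_cⁿG_(ℤ³)([x/δ]) → S n x and ρ_cⁿG_ext^δ([ιx/δ]) within ε of → S n (ιx); let ε → 0. Coincident x:
both sides 0. [difficulty: M] [FrancescoMathieuSenechal1997, Cardy1996]
#9 MoebiusOfTranslationInversion (support) — (group lemma, provable now, no regularity or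
normalisation of S needed) for every Δ and every S : CorrFamily 3, IsTranslationInvariant S →
IsInversionCovariant Δ S → IsMoebiusCovariant Δ S. Proof sketch (planner NOTES): ⟨translations, ι⟩ =
Möb(ℝ³∪∞): on a line ℝe the words generate PGL₂(ℝ), so some word g acts on the line as x ↦ λx;
g·d_λ⁻¹ fixes the line ∪ ∞ pointwise and commutes with O(2)_(e^⊥), hence g = d_λ or d_λ∘(point
reflection in the line) and g² = d_(λ²); on a plane the words generate PSL₂(ℂ) (z+a and ι t_a ι =
z/(1+āz)), so g² = rotation by 2θ about the normal; an odd word restricting to z ↦ z̄ is a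
reflection (orientation). Covariance transfers along words off the finite bad set where an
intermediate point hits 0, and the bad set is moved off any given configuration by conjugating the
word with a translation; the accumulated weight is the conformal factor of the composite (chain
rule), = c^(−nΔ) for dilations and 1 for isometries. Serves cards
inversion-first-moebius-from-translations / kelvin-image-of-a-uniform-field as well. [difficulty: L]
[FrancescoMathieuSenechal1997, BenedettiPetronio1992]
#9 GKSDomainMonotonicity (support) — (the comparison structure, provable now from
isingCorr_plus_le_of_subset and hasBoxLimit_isingCorr_plus_holds) for Ω ⊆ Ω′ ⊆ ℝ³, any δ, n and
sites y with δy_i ∈ Ω: G_Ω′^δ(y) ≤ G_Ω^δ(y) and criticalCorr 3 n y ≤ G_Ω′^δ(y) (fewer + spins ⇒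
smaller correlations; the bulk + state is below every + b.c. domain state). Gives at once the
envelopes 1 ≤ G_(B)^δ(x)/G_(H)^δ(x) for a ball B inside a half-space H, monotonicity of S_R in R,
and bulk ≤ S_R. [difficulty: provable-now] [FriedliVelenik2017,
Literature.Probability.LatticeModels.isingCorr_plus_le_of_subset]
#9 OnePointLaw (support) — (dividend and test target; the Loewner–Nirenberg density as 3-D conformal
radius) for Δ with ρ_c regularly varying of index −Δ there is ONE constant κ > 0 such that for every
R > 0 and every limit family S of the + ball of radius R (as in BallLimits), S 1 (x) = κ · (2R/(R² −
‖x‖²))^Δ = κ · u_(B_R)(x)^(2Δ) for ‖x‖ < R, u_(B_R) = (2R/(R²−|x|²))^(1/2) the Loewner–Nirenberg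
solution of the ball (hyperbolic conformal factor). κ independent of R is exact lattice dilation
consistency + RV; the profile shape is OIR on ball↔ball pairs plus translation covariance of ball
limits; κ > 0 follows from bulk non-degeneracy via the + wall decoupling ⟨σ_xσ_x̄⟩ ≤ m_H(x)² ≤
m_B(x)². Conjectural as a whole (implied by the cruxes up to similarity glue not filed).
[difficulty: L] [Cardy1996, BurkhardtEisenriegler1985, LoewnerNirenberg1974, arXiv:1904.08919]
#9 CentreWallRatio (support) — (the cheapest falsifier as a statement; renormalisation-free, n = 1)
for Δ with ρ_c regularly varying of index −Δ and every R > 0: ⟨σ_([Re_0/δ])⟩⁺ in the half-space {x_0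
> 0} (+ wall at distance R) divided by ⟨σ_([Re_0/δ])⟩⁺ in the ball B(Re_0, R) (+ sphere of radius R
around the point) tends to 2^(−Δ) ≈ 0.698 as δ → 0⁺. GKS gives ≤ 1 (the ball lies in the
half-space); the value 2^(−Δ) is OIR at n = 1 on the pair (B(ae_0,a), {x_0 > 1/(2a)}) transported by
a translation and a dilation (similarity glue as for OnePointLaw). [difficulty: L] [Cardy1996,
BurkhardtEisenriegler1985, Hasenbusch2013, arXiv:1904.08919]

TWO-LAYER PLAN. Foreseen glued splits (none filed now): UBF ⇐ FarSphere → SmallGrain → UBF (the two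
clauses; k = 2, glue trivial); BL ⇐ BallTightness
(subsequential locally uniform limits with continuous limit points: GKS/Simon–Lieb local
comparability + hyperscaling upper bound
ρ_c·⟨σ_x⟩⁺_(B) = O(1)) → BallUniqueness (all limit points agree) → BL; OIR ⇐ OIROnePoint (n = 1, all
ι-pairs: the profile laws) →
OIRHigher (n ≥ 2 given n = 1, e.g. via + b.c. FK/current representations) → OIR. The card's
COMPARISON ENGINE (D5) enters as a child of
OIROnePoint once the Loewner–Nirenberg definition lands: a discrete sub-mean-value inequality for
m_Ω = ⟨σ_x⟩⁺_Ω at β_c at scales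
1 ≪ r ≪ dist(x,∂Ω) makes m^(1/(2Δ))-type transforms Yamabe subsolutions, and LN maximality gives the
one-sided law m_Ω ≤ C·u_Ω^(2Δ)
on EVERY bounded domain; the matching lower bound on 𝒪 comes from nested-orbit GKS sandwiches.

KILL CRITERIA. (a) CentreWallRatio measured ≠ 2^(−Δ) = 0.698 (Δ = 0.5181) beyond errors at R = 8…48
— refutes OIR at n = 1 (up to the similarity
glue) and clause (ii) of the conjunct at the one-point level: close `refuted:OrbitInversionRatio`
and file the measured ratio as a
negative statement. (b) ¬TwoPointRegularVariation (η does not exist / log-periodic G) kills every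
single-Δ route including the
conjunct as typed — close and report upstream. (c) BallLimits refuted through ρ_c·⟨σ_x⟩⁺_(B_(R/δ)) →
∞ (upper hyperscaling fails)
while ball-normalised limits exist: pivot by `--restate` BL/UBF with the ball normalisation ρ_B(δ)
:= 1/⟨σ_0⟩⁺_(B_(1/δ)) and add the
comparability ρ_B ≍ ρ_c as an explicit crux (the conjunct may survive; the route's bet is
hyperscaling). (d) UniformBoundaryForgetting
refuted (boundary influence does not decay uniformly) — no passage from domains to the bulk: close
`refuted:UniformBoundaryForgetting`.
(e) If CritIsing3DEuclideanLimit (item 0638) or HyperoctahedralRP's ExistsScaleCovariantLimit is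
PROVED first, BL and the far half
of UBF are mooted for the conjunct: shrink to OIR + small-grain + group lemma by `route edit`.

NOT DECOMPOSED YET. Translation/dilation covariance of domain limits for domains not centred at 0
(needs stability of + b.c. states under O(δ)
boundary perturbations — a GKS sandwich between Ω shrunk/enlarged by δ plus continuity of S_Ω in Ω);
the similarity glue turning OIR
into OnePointLaw/CentreWallRatio; limits on half-spaces and exteriors themselves (only balls are
asserted to have limits; OIR and UBF
are limit-free); the general-domain one-point law and the Loewner–Nirenberg comparison engine (card
D5; definition request filed);
n-point tightness in balls beyond n = 2; any use of FK/random-current representations of + b.c.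
states (⟨σ_x⟩⁺_Ω = φ^(wired)[x ↔ ∂Ω]).
These are layer-2 children or `--supports` lemmas once a crux is stamped.

CHEAPEST FALSIFIER. Monte Carlo at β_c(ℤ³) = 0.221654626 (spin-1/2 or improved Blume–Capel):
magnetisation at the CENTRE of lattice balls of radius
R = 8, 12, 16, 24, 32, 48 with all outside spins frozen + versus the + wall profile at distance R
(half-space realised as an
L²×2L slab with one + wall, L ≥ 8R); the ratio wall/centre must tend to 2^(−Δ) = 0.6983 (Δ_σ =
0.5181489); GKS guarantees ≤ 1 and
monotone convergence aids extrapolation (corrections ∝ R^(−ω), ω ≈ 0.83). Existing data: the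
exterior-sphere/plate geometry of
Hasenbusch2013 is consistent with the conformal map of the wall profile; no + ball-INTERIOR
simulation was found (card audit; Galvani
thesis galaxy pdf:4118845800). Not run here (plancard seat, no kit job submitted); a refuter's first
move. Lookup falsifier: a
published 3-D boundary-CFT argument that the normal-transition one-point coefficient ratio differs
from the Möbius value would also
kill OIR — none found (BurkhardtEisenriegler1985 and Cardy1996 Ex. 11.2 derive exactly 2^Δ from
covariance).

NUMBERS. Δ_σ = 0.5181489(10) (conformal bootstrap, KosPolandSimmonsDuffinVichi2016;
PolandRychkovVichi2019 Table), so 2^Δ = 1.4322,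
2^(−Δ) = 0.6983, 2Δ = 1 + η with η = 0.036298; rigorous window Δ ∈ [1/2, 1]
(Literature.Probability.LatticeModels.criticalTwoPoint_bounds,
scalingDimension_mem_Icc); β_c(ℤ³) = 0.221654626(5). Loewner–Nirenberg on the orbit (d = 3, Δu =
¾u⁵): u_(B(c,R))(x) =
(2R/(R² − |x−c|²))^(1/2), u_(ℝ³∖B̄(c,R))(x) = (2R/(|x−c|² − R²))^(1/2), u_H(x) = dist(x,∂H)^(−1/2);
predicted profiles ⟨σ⟩⁺_Ω =
κ u_Ω^(2Δ): wall κ d^(−Δ), ball centre κ (2/R)^Δ, exterior κ (2R/(ρ²−R²))^Δ. Points are LN-removable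
in d = 3 (singular sets of
dimension < (d−2)/2 = 1/2), matching the removable + grain of UBF (influence ∝ r^Δ → 0). Items at
open: 12 (5 cruxes incl. shared
0636, 6 support, 1 assembly).

DEFINITION REQUESTS. Filed after open (for reuse by sibling cards
ball-specification-centre-blindness, kelvin-image-of-a-uniform-field,
boundary-influence-hyperscaling, film-ladder; this route's items INLINE the objects with `let` and
do not wait):
(1) `plusDomainCorr (Ω : Set (EuclideanSpace ℝ (Fin 3))) (δ : ℝ) : LatticeCorrFamily 3` — + b.c.
critical correlations in the lattice
region {z : δz ∈ Ω} as the box limit (topic Literature/Probability/LatticeModels), with the lemmas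
`antitone in Ω`, `bulk ≤`, `eventually
constant for bounded Ω`; (2) `loewnerNirenberg (Ω : Set (EuclideanSpace ℝ (Fin 3))) : EuclideanSpace
ℝ (Fin 3) → ℝ` — the maximal
solution of Δu = ¾u⁵ in Ω (topic Literature/Analysis/PDE), with named facts:
existence/uniqueness/maximality for bounded smooth Ω
and removability of boundary sets of Hausdorff dimension < 1/2 (LoewnerNirenberg1974; theorem
numbers to be quoted from the text once held — not materialised here), Möbius covariance
u_(φΩ)∘φ·|φ′|^(1/2) = u_Ω, antitonicity
in Ω, explicit values on 𝒪 (Numbers).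

Novelty: Searches (2026-08-15): `lit search --hybrid "order parameter profile critical Ising half-space
sphere fixed boundary conditions
conformal invariance"` (12 held books; hit: Cardy1996 Ch. 11 Ex. 11.2 — the ball profile from the
wall profile by an inversion, i.e.
the 2^Δ law as a textbook exercise; FrancescoMathieuSenechal1997 Ch. 11); crossref "Burkhardt
Eisenriegler universal order-parameter
profiles" (5: BurkhardtEisenriegler1985 = doi:10.1088/0305-4470/18/2/006, Burkhardt–Xue 1991
doi:10.1103/physrevlett.66.895);
crossref "Loewner Nirenberg conformal projective" (LoewnerNirenberg1974 =
doi:10.1016/b978-0-12-044850-0.50027-7); crossref Hasenbusch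
sphere–plate (Hasenbusch2013 = doi:10.1103/physreve.87.022130); s2 "geometric theory bounded
critical phenomena uniformization
Yamabe" (8: GoriTrombettoni2020 = arXiv:1904.08919; Aizenman arXiv:2112.04248 geometric perspective
— random currents, unrelated
mechanism); `lit frontier CriticalPhenomena --since 2021` (30 rows: arXiv:2604.05772 percolation in
3-D Ising, arXiv:2406.15243
FK-Ising IIC d ≥ 3 — read §1.4: Open problem 1 = one-arm conditioning, no one-arm bounds known);
`lit bridges CriticalPhenomena --cross
any`; `lit galaxy search … --star all` (galaxyd saturated, > 90 s queue, not retried);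
openalex/arxiv rate-limited today. Plus the
card's refuter audit (read arXiv:1904.08919 pp. 4-5, 17; Galvani thesis; Cosme–Lopes–Penedones
arXiv:1503.02011: free b.c. ball MC).
Nearest prior art found: BurkhardtEisenriegler1985 / Cardy199  [refs: 10.1088/0305-4470/18/2/006, 10.1103/physrevlett.66.895, 10.1016/b978-0-12-044850-0.50027-7, 10.1103/physreve.87.022130, 1904.08919, 2112.04248, 2604.05772, 2406.15243, 1503.02011, doi:10.1088/0305-4470/18/2/006, doi:10.1103/physrevlett.66.895, doi:10.1016/b978-0-12-044850-0.50027-7, doi:10.1103/physreve.87.022130, Cardy1996, FrancescoMathieuSenechal1997, BurkhardtEisenriegler1985, LoewnerNirenberg]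

Barriers (technique_class: domain-monotonicity, comparison-principle, inversion-first): - technique_class: domain-monotonicity, comparison-principle, inversion-first
- Literature.Barriers.CriticalPhenomena.ScaleCovarianceNotMoebius: evaded in TYPE — no item upgrades
Euclidean/scale data of an arbitrary correlation family (the barrier's witnessFamily has no + b.c.
domain versions and is not a limit of criticalCorr 3): OIR compares two Ising + b.c. lattice
families tied by exact monotonicity, InversionFromOrbit's hypotheses are Ising-specific (ρ_c,
criticalCorr 3, OIR, UBF), and MoebiusOfTranslationInversion ASSUMES inversion covariance. In
substance the physical obstruction (a virial current making the theory scale- but not conformally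
invariant) is exactly what would falsify OIR; acknowledged in its failure line and made measurable
by CentreWallRatio.
- Literature.Barriers.CriticalPhenomena.LiouvilleRigidity: respected and exploited — only Möbius
maps are used, and precisely because nothing else exists ONE orbit of domains
(balls/half-spaces/exteriors, the images of the ball) carries all the conformal content; no Riemann
map, no discrete holomorphicity; LiouvilleRigidityNarrow confirms Möbius covariance is the whole
target in d = 3.
- Literature.Barriers.CriticalPhenomena.BootstrapLatticeBlindness: not in class — every item is a
statement about lattice Gibbs states with boundary conditions; Δ_σ = 0.518 enters only as the test
value 2^(−Δ).
- Literature.Barriers.CriticalPhenomena.SlabLimitUniformControl: catalogued for the percolation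
conjunct, but its moral (uni

History (route lifecycle, newest last):
- 2026-08-16T02:18:02Z · AUTO-CRUX: 1 conjecture-grade item(s) promoted to crux (OnePointLaw) — refuter vetting / tiering apply (operator:999:1362873)
- 2026-08-24T06:31:17Z · DORMANT — reconciler: no traction for 6.6 d (last activity item-evidence-added at 2026-08-17T16:05:46Z); parked, not closed — `ledger route dormant route-CriticalPhenomen (operator:999:3714479)
- 2026-08-27T15:08:43Z · REACTIVATED — reconciler: reactivated — activity statement-checked at 2026-08-27T13:50:46Z after parking at 2026-08-24T06:31:17Z (operator:999:2978161)

sub-problem: Ising3DConformalLimit · status: open · opened planner-plancard-CriticalPhenomena-Ising3DCon-0f93f068-0 2026-08-15T11:39:23Z · rev 5 · ledger route-CriticalPhenomena-BallOrbitComparison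
GENERATED by the gate from the ledger (D-0016/17). Provers cite these decls: `theorem foo : Summit.CriticalPhenomena.Ising3DConformalLimit.Theses.BallOrbitComparison.<Decl> := …` in Summits/CriticalPhenomena/Ising3DConformalLimit/Theorems/<Name>.lean.
-/

namespace Summit.CriticalPhenomena.Ising3DConformalLimit.Theses.BallOrbitComparison

open scoped BigOperators Topology Manifold Classical MeasureTheory ProbabilityTheory Matrix InnerProductSpace ComplexConjugate ContinuousMap
open Filter Set Function TopologicalSpace MeasureTheory

attribute [summit_statement] _root_.Ising3DConformalLimit

/-- item stmt-CriticalPhenomena-5044 · crux · rank 2 · open · by planner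
why it might fail: It is clause (ii) read on + b.c. domains: a scale- but not conformally covariant critical point (virial current) would make ball and exterior/half-space correlations differ by a non-constant factor; GKS sandwiches give only one-sided bounds (ratio ≤ 1 for nested pairs), no lattice identity is known.
sources: Cardy1996, BurkhardtEisenriegler1985, arXiv:1904.08919, ChelkakHonglerIzyurov2015, DuminilCopinICM2022, Hasenbusch2013
[crux] (card D1, renormalisation-free form) let Δ be the regular-variation index of ρ_c. For Ω, Ω′
in the orbit 𝒪 (open balls, open exteriors of balls, open half-spaces of ℝ³) with ι(Ω∖0) ⊆ Ω′ and
ι(Ω′∖0) ⊆ Ω (ι = unit inversion x ↦ x/‖x‖²), every n and every non-coincident x with x_i ∈ Ω∖{0}: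
G_Ω′^δ([ιx_1/δ],…,[ιx_n/δ]) / G_Ω^δ([x_1/δ],…,[x_n/δ]) → ∏_i ‖x_i‖^(2Δ) as δ → 0⁺. Covers
ball↔exterior (0 inside), ball↔ball (0 outside), ball↔half-space (0 on the sphere),
half-space↔half-space (0 on the plane); n = 1 on the last-but-one pair is the 2^Δ centre/wall law.
[deps: TwoPointRegularVariation] [difficulty: open-problem] -/
@[route_item "route-CriticalPhenomena-BallOrbitComparison", crux]
def OrbitInversionRatio : Prop :=
  let G : Set (EuclideanSpace ℝ (Fin 3)) → ℝ → (n : ℕ) → (Fin n → Literature.Probability.LatticeModels.Site 3) → ℝ := fun Ω δ n (y : Fin n → Literature.Probability.LatticeModels.Site 3) => Filter.limUnder Filter.atTop (fun L : ℕ => Literature.Probability.LatticeModels.isingExpect (Literature.Probability.LatticeModels.zdGraph 3) ((Literature.Probability.LatticeModels.box 3 L).filter (fun z => (WithLp.toLp 2 (fun i : Fin 3 => δ * (z i : ℝ)) : EuclideanSpace ℝ (Fin 3)) ∈ Ω)) (Literature.Probability.LatticeModels.criticalBeta 3) 0 Literature.Probability.LatticeModels.BoundaryCondition.plus (Literature.Probability.LatticeModels.spinMonomial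 y)); let ρ : ℝ → ℝ := fun δ => 1 / Real.sqrt (Literature.Probability.LatticeModels.criticalTwoPoint 3 (Pi.single 0 ⌊δ⁻¹⌋)); let O : Set (Set (EuclideanSpace ℝ (Fin 3))) := {Ω | (∃ c R, 0 < R ∧ Ω = Metric.ball c R) ∨ (∃ c R, 0 < R ∧ Ω = {x | R < dist x c}) ∨ (∃ (v : EuclideanSpace ℝ (Fin 3)) (t : ℝ), v ≠ 0 ∧ Ω = {x | t < inner ℝ v x})}; ∀ Δ : ℝ, (∀ c : ℝ, 0 < c → Filter.Tendsto (fun δ => ρ (c * δ) / ρ δ) (nhdsWithin (0:ℝ) (Set.Ioi 0)) (nhds (c ^ (-Δ)))) → ∀ Ω ∈ O, ∀ Ω' ∈ O, Set.MapsTo (EuclideanGeometry.inversion 0 1) (Ω \ {0}) Ω' → Set.MapsTo (EuclideanGeometry.inversion 0 1) (Ω' \ {0}) Ω → ∀ n, ∀ x ∈ Literature.Probability.LatticeModels.NonCoincident 3 n, (∀ i, x i ∈ Ω ∧ x i ≠ 0) → Filter.Tendsto (fun δ => G Ω' δ n (fun i => Literature.Probability.LatticeModels.latticeApprox δ (EuclideanGeometry.inversion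 0 1 (x i))) / G Ω δ n (fun i => Literature.Probability.LatticeModels.latticeApprox δ (x i))) (nhdsWithin (0:ℝ) (Set.Ioi 0)) (nhds (∏ i, ‖x i‖ ^ (2 * Δ)))

/-- item stmt-CriticalPhenomena-5045 · crux · rank 3 · open · by planner
why it might fail: Finiteness under the bulk normalisation ρ_c contains two-point hyperscaling ⟨σ_0⟩^{+B_n} ≲ ⟨σ_0σ_{ne_0}⟩^{1/2} (one-arm ≤ √two-point), open on ℤ³ (no one-arm bound at all: arXiv:2406.15243 Open problem 1); and uniqueness of the δ→0 limit has no mechanism in d=3 beyond subsequences.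
sources: arXiv:2406.15243, AizenmanDuminilCopinSidoravicius2015, DuminilCopinICM2022, FriedliVelenik2017, arXiv:1912.07973
[crux] (card D2, finite-volume form) for every R > 0 there is a family S_R : CorrFamily 3 such that
for every n the ρ_c-renormalised + b.c. correlations of the lattice ball {z : |δz| < R} (a FINITE
system), x ↦ ρ_c(δ)ⁿ G_(B_R)^δ([x_1/δ],…,[x_n/δ]), converge locally uniformly on NonCoincident ∩
B_Rⁿ to S_R n as δ → 0⁺, and S_R n is continuous there. With UniformBoundaryForgetting this yields
the bulk limit (support BulkFromBalls): existence of the scaling limit becomes a finite-volume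
problem plus one uniform estimate. [difficulty: open-problem] -/
@[route_item "route-CriticalPhenomena-BallOrbitComparison", crux]
def BallLimits : Prop :=
  let G : Set (EuclideanSpace ℝ (Fin 3)) → ℝ → (n : ℕ) → (Fin n → Literature.Probability.LatticeModels.Site 3) → ℝ := fun Ω δ n (y : Fin n → Literature.Probability.LatticeModels.Site 3) => Filter.limUnder Filter.atTop (fun L : ℕ => Literature.Probability.LatticeModels.isingExpect (Literature.Probability.LatticeModels.zdGraph 3) ((Literature.Probability.LatticeModels.box 3 L).filter (fun z => (WithLp.toLp 2 (fun i : Fin 3 => δ * (z i : ℝ)) : EuclideanSpace ℝ (Fin 3)) ∈ Ω)) (Literature.Probability.LatticeModels.criticalBeta 3) 0 Literature.Probability.LatticeModels.BoundaryCondition.plus (Literature.Probability.LatticeModels.spinMonomial y)); let ρ : ℝ → ℝ := fun δ => 1 / Real.sqrt (Literature.Probability.LatticeModels.criticalTwoPoint 3 (Pi.single 0 ⌊δ⁻¹⌋)); ∀ R : ℝ, 0 < R → ∃ S : Literature.Probability.LatticeModels.CorrFamily 3, (∀ n, TendstoLocallyUniformlyOn (fun δ x => ρ δ ^ n * G (Metric.ball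 (0 : EuclideanSpace ℝ (Fin 3)) R) δ n (fun i => Literature.Probability.LatticeModels.latticeApprox δ (x i))) (S n) (nhdsWithin (0:ℝ) (Set.Ioi 0)) (Literature.Probability.LatticeModels.NonCoincident 3 n ∩ {x | ∀ i, x i ∈ Metric.ball (0 : EuclideanSpace ℝ (Fin 3)) R})) ∧ ∀ n, ContinuousOn (S n) (Literature.Probability.LatticeModels.NonCoincident 3 n ∩ {x | ∀ i, x i ∈ Metric.ball (0 : EuclideanSpace ℝ (Fin 3)) R})

/-- item stmt-CriticalPhenomena-5046 · crux · rank 4 · open · by planner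
why it might fail: It is a polynomial decay of + boundary influence across scales (FK-Ising one-arm type, from a macroscopic + seed), UNIFORM in the mesh: open in d=3 even without uniformity (ADS continuity gives →0 with no rate); slab moral: uniform control in the exhaustion parameter can be as hard as the target.
sources: AizenmanDuminilCopinSidoravicius2015, arXiv:2406.15243, arXiv:1912.07973, Literature.Barriers.CriticalPhenomena.SlabLimitUniformControl, FriedliVelenik2017
[crux] (card D3: exhaustion + removable grain, uniform in the mesh) for every n, every compact K ⊆
NonCoincident 3 n and ε > 0: (far sphere) there is R₀ such that for all R ≥ R₀, all sufficiently
small δ > 0 and all x ∈ K, |ρ_c(δ)ⁿ (G_(B_R)^δ − G_(ℤ³))([x/δ])| < ε, where G_(ℤ³) = criticalCorr 3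
is the bulk + state; (small grain) if K avoids configurations through 0, there is r₀ such that for
all r ∈ (0, r₀], small δ and x ∈ K, |ρ_c(δ)ⁿ (G_({|y|>r})^δ − G_(ℤ³))([x/δ])| < ε (+ grain of radius
r/δ at the origin). Both differences are ≥ 0 and monotone in R, r by GKS; the two halves are images
of each other under ι. [difficulty: open-problem] -/
@[route_item "route-CriticalPhenomena-BallOrbitComparison", crux]
def UniformBoundaryForgetting : Prop :=
  let G : Set (EuclideanSpace ℝ (Fin 3)) → ℝ → (n : ℕ) → (Fin n → Literature.Probability.LatticeModels.Site 3) → ℝ := fun Ω δ n (y : Fin n → Literature.Probability.LatticeModels.Site 3) => Filter.limUnder Filter.atTop (fun L : ℕ => Literature.Probability.LatticeModels.isingExpect (Literature.Probability.LatticeModels.zdGraph 3) ((Literature.Probability.LatticeModels.box 3 L).filter (fun z => (WithLp.toLp 2 (fun i : Fin 3 => δ * (z i : ℝ)) : EuclideanSpace ℝ (Fin 3)) ∈ Ω)) (Literature.Probability.LatticeModels.criticalBeta 3) 0 Literature.Probability.LatticeModels.BoundaryCondition.plus (Literature.Probability.LatticeModels.spinMonomial y)); let ρ : ℝ → ℝ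 := fun δ => 1 / Real.sqrt (Literature.Probability.LatticeModels.criticalTwoPoint 3 (Pi.single 0 ⌊δ⁻¹⌋)); ∀ (n : ℕ) (K : Set (Fin n → EuclideanSpace ℝ (Fin 3))), IsCompact K → K ⊆ Literature.Probability.LatticeModels.NonCoincident 3 n → ∀ ε : ℝ, 0 < ε → (∃ R₀ : ℝ, 0 < R₀ ∧ ∀ R, R₀ ≤ R → Filter.Eventually (fun δ => ∀ x ∈ K, |ρ δ ^ n * (G (Metric.ball (0 : EuclideanSpace ℝ (Fin 3)) R) δ n (fun i => Literature.Probability.LatticeModels.latticeApprox δ (x i)) - Literature.Probability.LatticeModels.criticalCorr 3 n (fun i => Literature.Probability.LatticeModels.latticeApprox δ (x i)))| < ε) (nhdsWithin (0:ℝ) (Set.Ioi 0))) ∧ ((∀ x ∈ K, ∀ i, x i ≠ 0) → ∃ r₀ : ℝ, 0 < r₀ ∧ ∀ r ∈ Set.Ioc 0 r₀, Filter.Eventually (fun δ => ∀ x ∈ K, |ρ δ ^ n * (G {y | r < ‖y‖} δ n (fun i => Literature.Probability.LatticeModels.latticeApprox δ (x i)) - Literature.Probability.LatticeModels.criticalCorr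 3 n (fun i => Literature.Probability.LatticeModels.latticeApprox δ (x i)))| < ε) (nhdsWithin (0:ℝ) (Set.Ioi 0)))

/-- item stmt-CriticalPhenomena-5047 · crux · rank 5 · open · by planner
why it might fail: η(3) need not exist: rigorously only c|x|⁻² ≤ G ≤ C|x|⁻¹ and 'η ≤ 1/2 if it exists' (arXiv:2404.05700 Thm 1.5); a log-periodic modulation |x|^{-1-η}(1 + a·cos(ω log|x|)) is compatible with every known inequality (card rp-cannot-fix-the-scale-log-periodic).
sources: arXiv:2404.05700, DuminilcopinPanis2025, DuminilCopinICM2022, Literature.Probability.LatticeModels.criticalTwoPoint_bounds, Simon1980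
[crux] there is Δ > 0 with ρ_c(cδ)/ρ_c(δ) → c^(−Δ) as δ → 0⁺ for every c > 0, ρ_c(δ) =
⟨σ_0σ_(⌊1/δ⌋e_0)⟩_(β_c(3))^(−1/2); i.e. n ↦ ⟨σ_0σ_(ne_0)⟩_(β_c) is regularly varying of index −2Δ =
−(1+η) (existence of η in Karamata form). Fixes the route's Δ; criticalTwoPoint_bounds then forces Δ
∈ [1/2, 1]. Strictly stronger than item 0635 (log form). [difficulty: open-problem] -/
@[route_item "route-CriticalPhenomena-BallOrbitComparison", crux]
def TwoPointRegularVariation : Prop :=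
  let ρ : ℝ → ℝ := fun δ => 1 / Real.sqrt (Literature.Probability.LatticeModels.criticalTwoPoint 3 (Pi.single 0 ⌊δ⁻¹⌋)); ∃ Δ : ℝ, 0 < Δ ∧ (∀ c : ℝ, 0 < c → Filter.Tendsto (fun δ => ρ (c * δ) / ρ δ) (nhdsWithin (0:ℝ) (Set.Ioi 0)) (nhds (c ^ (-Δ))))

/-- item stmt-CriticalPhenomena-0636 · crux · rank 6 · open · by planner
why it might fail: No proof that U4≢0 in d=3: via U4 = −2⟨σσ⟩⟨σσ⟩·P[two double-current clusters meet], the intersection probability must stay >0 at macroscopic separation as δ→0 — unproved on n.n. ℤ³; RP long-range models ON ℤ³ (α<3/2) are Gaussian.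
sources: AizenmanDuminilCopinAnnals2021, arXiv:1912.07973, Panis2023Triviality, Literature.Barriers.CriticalPhenomena.IsingTrivialityFromDimensionFour, DuminilCopinICM2022
Crux r4 (non-triviality in d=3): every non-degenerate pointwise scaling limit S of the renormalised
critical Ising correlators on Z^3 has connected four-point function U4 ≢ 0 on non-coincident
configurations. Intended tool: the random-current identity U4(x,y,z,t) =
−2⟨σxσy⟩⟨σzσt⟩·P^{xy,zt}[C_{n1+n2}(x) ∩ C_{n1+n2}(z) ≠ ∅] (Aizenman 1982; ADC2021 arXiv:1912.07973
eq. (3.11)): non-Gaussianity ⇔ the intersection probability of the two double-current clusters at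
macroscopic separation does not vanish as δ → 0. Contrast: for d ≥ 4 every such limit IS Gaussian
(Literature.Probability.LatticeModels.highDim_triviality). Its negation refutes the conjunct
Ising3DConformalLimit itself. -/
@[route_item "route-CriticalPhenomena-BallOrbitComparison", crux]
def IsingEuclidUpgradeR4NonGaussian : Prop :=
  ∀ (ρ : ℝ → ℝ) (S : Literature.Probability.LatticeModels.CorrFamily 3), (∀ δ ∈ Set.Ioc (0:ℝ) 1, 0 < ρ δ) → Literature.Probability.LatticeModels.HasPointwiseScalingLimit (Literature.Probability.LatticeModels.criticalCorr 3) ρ S → Literature.Probability.LatticeModels.IsNondegenerateTwoPoint S → Literature.Probability.LatticeModels.HasNontrivialU4 S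

/-- item stmt-CriticalPhenomena-5051 · crux (kind.auto-crux: conjecture-grade) · rank 9 · open · by planner
why it might fail: auto-crux — conjecture-grade statement (docstring avows it ('Conjectural')); it is open, so it may simply be false
sources: Cardy1996, BurkhardtEisenriegler1985, LoewnerNirenberg1974, arXiv:1904.08919
[support] (dividend and test target; the Loewner–Nirenberg density as 3-D conformal radius) for Δ
with ρ_c regularly varying of index −Δ there is ONE constant κ > 0 such that for every R > 0 and
every limit family S of the + ball of radius R (as in BallLimits), S 1 (x) = κ · (2R/(R² − ‖x‖²))^Δ
= κ · u_(B_R)(x)^(2Δ) for ‖x‖ < R, u_(B_R) = (2R/(R²−|x|²))^(1/2) the Loewner–Nirenberg solution of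
the ball (hyperbolic conformal factor). κ independent of R is exact lattice dilation consistency +
RV; the profile shape is OIR on ball↔ball pairs plus translation covariance of ball limits; κ > 0
follows from bulk non-degeneracy via the + wall decoupling ⟨σ_xσ_x̄⟩ ≤ m_H(x)² ≤ m_B(x)².
Conjectural as a whole (implied by the cruxes up to similarity glue not filed). [difficulty: L] -/
@[route_item "route-CriticalPhenomena-BallOrbitComparison", crux]
def OnePointLaw : Prop :=
  let G : Set (EuclideanSpace ℝ (Fin 3)) → ℝ → (n : ℕ) → (Fin n → Literature.Probability.LatticeModels.Site 3) → ℝ := fun Ω δ n (y : Fin n → Literature.Probability.LatticeModels.Site 3) => Filter.limUnder Filter.atTop (fun L : ℕ => Literature.Probability.LatticeModels.isingExpect (Literature.Probability.LatticeModels.zdGraph 3) ((Literature.Probability.LatticeModels.box 3 L).filter (fun z => (WithLp.toLp 2 (fun i : Fin 3 => δ * (z i : ℝ)) : EuclideanSpace ℝ (Fin 3)) ∈ Ω)) (Literature.Probability.LatticeModels.criticalBeta 3) 0 Literature.Probability.LatticeModels.BoundaryCondition.plus (Literature.Probability.LatticeModels.spinMonomial y)); let ρ : ℝ → ℝ :=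 fun δ => 1 / Real.sqrt (Literature.Probability.LatticeModels.criticalTwoPoint 3 (Pi.single 0 ⌊δ⁻¹⌋)); ∀ Δ : ℝ, (∀ c : ℝ, 0 < c → Filter.Tendsto (fun δ => ρ (c * δ) / ρ δ) (nhdsWithin (0:ℝ) (Set.Ioi 0)) (nhds (c ^ (-Δ)))) → ∃ κ : ℝ, 0 < κ ∧ ∀ R : ℝ, 0 < R → ∀ S : Literature.Probability.LatticeModels.CorrFamily 3, (∀ n, TendstoLocallyUniformlyOn (fun δ x => ρ δ ^ n * G (Metric.ball (0 : EuclideanSpace ℝ (Fin 3)) R) δ n (fun i => Literature.Probability.LatticeModels.latticeApprox δ (x i))) (S n) (nhdsWithin (0:ℝ) (Set.Ioi 0)) (Literature.Probability.LatticeModels.NonCoincident 3 n ∩ {x | ∀ i, x i ∈ Metric.ball (0 : EuclideanSpace ℝ (Fin 3)) R})) → ∀ x ∈ Metric.ball (0 : EuclideanSpace ℝ (Fin 3)) R, S 1 (fun _ => x) = κ * (2 * R / (R ^ 2 - ‖x‖ ^ 2)) ^ Δ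

/-- item stmt-CriticalPhenomena-4726 · support · rank 9 · open · by planner
sources: FrancescoMathieuSenechal1997, BenedettiPetronio1992
[support] (glue, provable now; card inversion-first-moebius-from-translations states the group fact)
Translation invariance + inversion covariance with Δ ⇒ IsMoebiusCovariant Δ S (rotations AND
dilations are output). In every plane through an axis ℝe the maps z ↦ z+s and ι∘τ_{se}∘ι : z ↦
z/(1+sz) generate PSL₂(ℝ) ∋ (z ↦ λz, z ↦ −1/z = ι∘ρ_e), so dilations and all reflections ρ_e are
finite words in translations and ι; apply the two covariance laws along the word after conjugating
by a generic translation so that no intermediate point hits the pole (finitely many excluded v); the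
cocycle ∏|φ′(xᵢ)|^{-Δ} closes by the chain rule. No normalisation or positivity of Δ needed.
[difficulty: provable-now] -/
@[route_item "route-CriticalPhenomena-BallOrbitComparison", crux]
def MoebiusOfTranslationInversion : Prop :=
  ∀ (Δ : ℝ) (S : Literature.Probability.LatticeModels.CorrFamily 3), Literature.Probability.LatticeModels.IsTranslationInvariant S → Literature.Probability.LatticeModels.IsInversionCovariant Δ S → Literature.Probability.LatticeModels.IsMoebiusCovariant Δ S

/-- item stmt-CriticalPhenomena-5048 · support · rank 9 · open · by planner
sources: FriedliVelenik2017, MessagerMiracleSoleJSP1977, Literature.Probability.LatticeModels.isingCorr_plus_le_of_subset, Literature.Probability.LatticeModels.plusCorr_shift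
[support] (glue, provable now given its antecedents) for Δ with ρ_c regularly varying of index −Δ:
BallLimits → UniformBoundaryForgetting → there is S : CorrFamily 3, normalised to 0 off
NonCoincident, with ρ_c > 0 on (0,1] (criticalTwoPoint_bounds_holds), HasPointwiseScalingLimit
(criticalCorr 3) ρ_c S (GKS: bulk = inf of balls, isingCorr_plus_le_of_subset +
hasBoxLimit_isingCorr_plus_holds; Moore–Osgood with the uniform estimate; S = lim_R S_R locally
uniformly, hence continuous), IsNondegenerateTwoPoint S (canonical normalisation S 2 (0,e_0) = 1,
Messager–Miracle-Solé messager_miracleSole(_diag)_holds + reflections), IsTranslationInvariant S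
(plusCorr_shift + continuity: [x/δ+v/δ] = [(x+δθ)/δ] + ⌊v/δ⌋), IsScaleCovariant Δ S (δ ↦ cδ in the
mesh filter + regular variation). [difficulty: L] -/
@[route_item "route-CriticalPhenomena-BallOrbitComparison", crux]
def BulkFromBalls : Prop :=
  let ρ : ℝ → ℝ := fun δ => 1 / Real.sqrt (Literature.Probability.LatticeModels.criticalTwoPoint 3 (Pi.single 0 ⌊δ⁻¹⌋)); ∀ Δ : ℝ, (∀ c : ℝ, 0 < c → Filter.Tendsto (fun δ => ρ (c * δ) / ρ δ) (nhdsWithin (0:ℝ) (Set.Ioi 0)) (nhds (c ^ (-Δ)))) → BallLimits → UniformBoundaryForgetting → ∃ S : Literature.Probability.LatticeModels.CorrFamily 3, (∀ n x, x ∉ Literature.Probability.LatticeModels.NonCoincident 3 n → S n x = 0) ∧ (∀ δ ∈ Set.Ioc (0:ℝ) 1, 0 < ρ δ) ∧ Literature.Probability.LatticeModels.HasPointwiseScalingLimit (Literature.Probability.LatticeModels.criticalCorr 3) ρ S ∧ Literature.Probability.LatticeModels.IsNondegenerateTwoPoint S ∧ Literature.Probability.LatticeModels.IsTranslationInvariant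 S ∧ Literature.Probability.LatticeModels.IsScaleCovariant Δ S

/-- item stmt-CriticalPhenomena-5049 · support · rank 9 · open · by planner
sources: FrancescoMathieuSenechal1997, Cardy1996
[support] (glue, provable now given its antecedents; ε-argument written out in planner NOTES) for Δ
with ρ_c regularly varying of index −Δ: OrbitInversionRatio → UniformBoundaryForgetting → every S
with HasPointwiseScalingLimit (criticalCorr 3) ρ_c S and S = 0 off NonCoincident is inversion
covariant, IsInversionCovariant Δ S. Proof: for non-coincident x with x_i ≠ 0 pick R ≥ max(R₀, 1/r₀,
2 max‖x_i‖); OIR on the ι-pair (ball 0 R, {‖y‖ > 1/R}) gives G_ext^δ([ιx/δ])/G_ball^δ([x/δ]) →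
∏‖x_i‖^(2Δ); UBF puts ρ_cⁿG_ball^δ([x/δ]) within ε of ρ_cⁿG_(ℤ³)([x/δ]) → S n x and
ρ_cⁿG_ext^δ([ιx/δ]) within ε of → S n (ιx); let ε → 0. Coincident x: both sides 0. [difficulty: M] -/
@[route_item "route-CriticalPhenomena-BallOrbitComparison", crux]
def InversionFromOrbit : Prop :=
  let ρ : ℝ → ℝ := fun δ => 1 / Real.sqrt (Literature.Probability.LatticeModels.criticalTwoPoint 3 (Pi.single 0 ⌊δ⁻¹⌋)); ∀ Δ : ℝ, (∀ c : ℝ, 0 < c → Filter.Tendsto (fun δ => ρ (c * δ) / ρ δ) (nhdsWithin (0:ℝ) (Set.Ioi 0)) (nhds (c ^ (-Δ)))) → OrbitInversionRatio → UniformBoundaryForgetting → ∀ S : Literature.Probability.LatticeModels.CorrFamily 3, Literature.Probability.LatticeModels.HasPointwiseScalingLimit (Literature.Probability.LatticeModels.criticalCorr 3) ρ S → (∀ n x, x ∉ Literature.Probability.LatticeModels.NonCoincident 3 n → S n x = 0) → Literature.Probability.LatticeModels.IsInversionCovariant Δ S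

/-- item stmt-CriticalPhenomena-5050 · support · rank 9 · open · by planner
sources: FriedliVelenik2017, Literature.Probability.LatticeModels.isingCorr_plus_le_of_subset
[support] (the comparison structure, provable now from isingCorr_plus_le_of_subset and
hasBoxLimit_isingCorr_plus_holds) for Ω ⊆ Ω′ ⊆ ℝ³, any δ, n and sites y with δy_i ∈ Ω: G_Ω′^δ(y) ≤
G_Ω^δ(y) and criticalCorr 3 n y ≤ G_Ω′^δ(y) (fewer + spins ⇒ smaller correlations; the bulk + state
is below every + b.c. domain state). Gives at once the envelopes 1 ≤ G_(B)^δ(x)/G_(H)^δ(x) for a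
ball B inside a half-space H, monotonicity of S_R in R, and bulk ≤ S_R. [difficulty: provable-now] -/
@[route_item "route-CriticalPhenomena-BallOrbitComparison", crux]
def GKSDomainMonotonicity : Prop :=
  let G : Set (EuclideanSpace ℝ (Fin 3)) → ℝ → (n : ℕ) → (Fin n → Literature.Probability.LatticeModels.Site 3) → ℝ := fun Ω δ n (y : Fin n → Literature.Probability.LatticeModels.Site 3) => Filter.limUnder Filter.atTop (fun L : ℕ => Literature.Probability.LatticeModels.isingExpect (Literature.Probability.LatticeModels.zdGraph 3) ((Literature.Probability.LatticeModels.box 3 L).filter (fun z => (WithLp.toLp 2 (fun i : Fin 3 => δ * (z i : ℝ)) : EuclideanSpace ℝ (Fin 3)) ∈ Ω)) (Literature.Probability.LatticeModels.criticalBeta 3) 0 Literature.Probability.LatticeModels.BoundaryCondition.plus (Literature.Probability.LatticeModels.spinMonomial y)); ∀ (Ω Ω' : Set (EuclideanSpace ℝ (Fin 3))), Ω ⊆ Ω' → ∀ (δ : ℝ) (n : ℕ) (y : Fin n → Literature.Probability.LatticeModels.Site 3), (∀ i, (WithLp.toLp 2 (fun j : Fin 3 => δ * (y i j : ℝ)) :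 EuclideanSpace ℝ (Fin 3)) ∈ Ω) → G Ω' δ n y ≤ G Ω δ n y ∧ Literature.Probability.LatticeModels.criticalCorr 3 n y ≤ G Ω' δ n y

/-- item stmt-CriticalPhenomena-5052 · support · rank 9 · open · by planner
sources: Cardy1996, BurkhardtEisenriegler1985, Hasenbusch2013, arXiv:1904.08919
[support] (the cheapest falsifier as a statement; renormalisation-free, n = 1) for Δ with ρ_c
regularly varying of index −Δ and every R > 0: ⟨σ_([Re_0/δ])⟩⁺ in the half-space {x_0 > 0} (+ wall
at distance R) divided by ⟨σ_([Re_0/δ])⟩⁺ in the ball B(Re_0, R) (+ sphere of radius R around the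
point) tends to 2^(−Δ) ≈ 0.698 as δ → 0⁺. GKS gives ≤ 1 (the ball lies in the half-space); the value
2^(−Δ) is OIR at n = 1 on the pair (B(ae_0,a), {x_0 > 1/(2a)}) transported by a translation and a
dilation (similarity glue as for OnePointLaw). [difficulty: L] -/
@[route_item "route-CriticalPhenomena-BallOrbitComparison", crux]
def CentreWallRatio : Prop :=
  let G : Set (EuclideanSpace ℝ (Fin 3)) → ℝ → (n : ℕ) → (Fin n → Literature.Probability.LatticeModels.Site 3) → ℝ := fun Ω δ n (y : Fin n → Literature.Probability.LatticeModels.Site 3) => Filter.limUnder Filter.atTop (fun L : ℕ => Literature.Probability.LatticeModels.isingExpect (Literature.Probability.LatticeModels.zdGraph 3) ((Literature.Probability.LatticeModels.box 3 L).filter (fun z => (WithLp.toLp 2 (fun i : Fin 3 => δ * (z i : ℝ)) : EuclideanSpace ℝ (Fin 3)) ∈ Ω)) (Literature.Probability.LatticeModels.criticalBeta 3) 0 Literature.Probability.LatticeModels.BoundaryCondition.plus (Literature.Probability.LatticeModels.spinMonomial y)); let ρ : ℝ → ℝ := fun δ => 1 / Real.sqrt (Literature.Probability.LatticeModels.criticalTwoPoint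 3 (Pi.single 0 ⌊δ⁻¹⌋)); ∀ Δ : ℝ, (∀ c : ℝ, 0 < c → Filter.Tendsto (fun δ => ρ (c * δ) / ρ δ) (nhdsWithin (0:ℝ) (Set.Ioi 0)) (nhds (c ^ (-Δ)))) → ∀ R : ℝ, 0 < R → Filter.Tendsto (fun δ => G {x | 0 < x 0} δ 1 (fun _ => Literature.Probability.LatticeModels.latticeApprox δ (EuclideanSpace.single 0 R)) / G (Metric.ball (EuclideanSpace.single 0 R) R) δ 1 (fun _ => Literature.Probability.LatticeModels.latticeApprox δ (EuclideanSpace.single 0 R))) (nhdsWithin (0:ℝ) (Set.Ioi 0)) (nhds ((2:ℝ) ^ (-Δ)))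

/-- item stmt-CriticalPhenomena-5053 · assembly · rank 1 · open · by planner
sources: DuminilCopinICM2022, ChelkakHonglerIzyurov2015
[assembly] TwoPointRegularVariation → BallLimits → OrbitInversionRatio → UniformBoundaryForgetting →
BulkFromBalls → InversionFromOrbit → MoebiusOfTranslationInversion → IsingEuclidUpgradeR4NonGaussian
→ Ising3DConformalLimit. -/
@[route_item "route-CriticalPhenomena-BallOrbitComparison"]
def Assembly : Prop :=
  TwoPointRegularVariation → BallLimits → OrbitInversionRatio → UniformBoundaryForgetting → BulkFromBalls → InversionFromOrbit → MoebiusOfTranslationInversion → IsingEuclidUpgradeR4NonGaussian → Ising3DConformalLimit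

/-! D-0027 §2.1 — DECIDING THEOREM (planner-authored via `route open/edit --closes-file`; by planner-rrepair-CriticalPhenomena-BallOrbitCom-e84676c5-g2-0 2026-08-15T16:54:27Z):
its hypotheses are this route's items and its conclusion the sub-problem Statement (glue_lint), and it elaborates with this file. -/

@[closes "route-CriticalPhenomena-BallOrbitComparison"] theorem closes (h_OrbitInversionRatio : OrbitInversionRatio) (h_BallLimits : BallLimits)
    (h_UniformBoundaryForgetting : UniformBoundaryForgetting)
    (h_TwoPointRegularVariation : TwoPointRegularVariation)
    (h_IsingEuclidUpgradeR4NonGaussian : IsingEuclidUpgradeR4NonGaussian)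
    (h_MoebiusOfTranslationInversion : MoebiusOfTranslationInversion)
    (h_BulkFromBalls : BulkFromBalls) (h_InversionFromOrbit : InversionFromOrbit)
    (_h_GKSDomainMonotonicity : GKSDomainMonotonicity) (_h_OnePointLaw : OnePointLaw)
    (_h_CentreWallRatio : CentreWallRatio) : _root_.Ising3DConformalLimit := by
  -- RV fixes Δ > 0 and the regular variation of the canonical renormalisation ρ_c
  obtain ⟨Δ, hΔ, hrv⟩ := h_TwoPointRegularVariation
  -- BulkFromBalls (fed Δ, BL, UBF): the bulk limit S with ρ_c > 0 on (0,1], the pointwise scaling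
  -- limit, non-degeneracy, translation invariance (and scale covariance, unused below)
  obtain ⟨S, hS0, hρ, hlim, hnd, htr, _hsc⟩ :=
    h_BulkFromBalls Δ hrv h_BallLimits h_UniformBoundaryForgetting
  -- InversionFromOrbit (fed Δ, OIR, UBF, S) gives inversion covariance; the group lemma upgrades
  -- translations + inversion to the Möbius group; item 0636 gives U₄ ≢ 0
  exact ⟨_, Δ, S, hρ, hΔ, hlim, hnd,
    h_MoebiusOfTranslationInversion Δ S htr
      (h_InversionFromOrbit Δ hrv h_OrbitInversionRatio h_UniformBoundaryForgetting S hlim hS0),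
    h_IsingEuclidUpgradeR4NonGaussian _ S hρ hlim hnd⟩

end Summit.CriticalPhenomena.Ising3DConformalLimit.Theses.BallOrbitComparison
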